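import Summits.QuantumFields.BalabanUV.T4Continuum.Support.AveragingDeficitNearIdentity
import Summits.QuantumFields.BalabanUV.T4Continuum.Support.MinimalActionRate
import Literature.MathematicalPhysics.QuantumFieldTheory.Balaban1983to89.B7Prop1Local
import Literature.MathematicalPhysics.QuantumFieldTheory.Balaban1983to89.B12Average05And08
import Literature.MathematicalPhysics.QuantumFieldTheory.Balaban1983to89.B9Eq3114Proof
import Literature.MathematicalPhysics.QuantumFieldTheory.Balaban1983to89.B14Eq123Localization
import HarnessLib

/-!
# NE7LatticeBianchi — THE LATTICE BIANCHI IDENTITY for the Wilson flux: EXACT in any group (the cube identity), and LINEARISED with a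
# second-order defect for `U(N)`-valued small-field configurations (`‖(d_U F)(cube)‖ ≤ 248·a²`) — step (E1)-0 of the energy road (h7)

Cell `pub-balaban`, rung (B)+1 sub-cell t4, lineage `b2b-balaban-t4-ne7-p1`, generation 61 (CRUX PROVER NE7 #1, ruling e34b3e0c (2)); hunt (h7)
«ENERGY ROAD to the (A)-bill at data with curvature» of `t4/b2b-balaban-t4-ne7-p1-g61/HUNT-H7-ENERGY-ROAD.md` (its step (E1): a lattice
Weitzenböck inequality `Σ‖∇_U F‖² ≤ C₁Σ‖δ_U F‖² + C₂·a·Σ‖F‖²` needs the covariant exterior derivative of the flux to be second order — THIS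
file).  HONEST FRAMING (page 1): FIXED FINITE T⁴ (here: any `ℤ^d`, any `U(N)`), rung (B)+1; NE7, NE3 NOT PRINTED in
[Balaban1984PropagatorsI]–[Balaban1989LargeFieldII] and NOT PROVED here; continuum YM on T⁴ ⇐ BetaPertH ∧ nine spine estimates (0/9 proved);
BetaPertH ⇐ (D1) ∧ (D4) ∧ CAP+tail; G-an2-4 gates asym, D1 and NE2/3/4; NOT infinite volume, NOT mass gap, NOT Clay.

WHAT ([folklore] lattice gauge algebra over the tree's `B7Prop1Explicit.hol` ∕ `plaqWord` ∕ `ladder` and `T4AveragingDeficitWall.flux` ∕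
`covGrad` ∕ `Ad`; 0 def; 0 sorry).
§1 (any group `G`) `hol_ladder_nil`; **`cube_identity`** — non-abelian Stokes for the ladder over a plaquette word, read two ways
(`B7Prop1Explicit.hol_ladder` versus four `hol_ladder_cons`): the covariant transport defect of the `κμ`-plaquette holonomy along `e_ν`,
`P_{κμ}(x)·V(x,ν)·P_{κμ}(x+e_ν)⁻¹·V(x,ν)⁻¹`, EQUALS the ordered product of the four side faces of the cube `(x; κ, μ, ν)` conjugated by the
partial transports along `∂p_{κμ}`; `hol_lplaqWord_false` (a reversed side face from the far corner is `V(y,κ)⁻¹·P_{κν}(y)⁻¹·V(y,κ)`);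
**`cube_identity_faces`**: the same with every face a plaquette holonomy at its own corner —
`P·W·P′⁻¹·W⁻¹ = [P Q⁻¹ P⁻¹]·[P D R′⁻¹ D⁻¹ P⁻¹]·[A Q′ A⁻¹]·R` (`P = P_{κμ}(x)`, `P′ = P_{κμ}(x+e_ν)`, `W = V(x,ν)`, `Q = P_{μν}(x)`,
`Q′ = P_{μν}(x+e_κ)`, `R = P_{κν}(x)`, `R′ = P_{κν}(x+e_μ)`, `A = V(x,κ)`, `D = V(x,μ)`; closed by `group`).
§2 (any complete normed `ℂ`-algebra) **`norm_mlog_two_four`**: if `X·Y = X₁X₂X₃X₄` with all six within `a ≤ 1∕50`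
of `1` then `‖(log X + log Y) − (log X₁ + log X₂ + log X₃ + log X₄)‖ ≤ 240·a²` (the product rule `‖log(WX) − log W − log X‖ ≤ 4(p+q)²`,
`B12Average05And08.norm_mlog_mul_sub_le`, thrice; `B14Eq123Localization.norm_mul_sub_one_le` for the partial products).
§3 (`U(N)`) `norm_Ad_sub_one`, `flux_eq_mlog_hol`, **`covariant_bianchi_le`**: for `IsUnitaryCfg U`, `SmallField U a`, `a ≤ 1∕50`, `κ < μ < ν`:
  `‖∇_κ F_{μν}(x) − ∇_μ F_{κν}(x) + ∇_ν F_{κμ}(x)‖ ≤ 248·a²`,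
`∇ = covGrad U`, `F = flux U` (logs of the two sides of §1: `log(uXu⁻¹) = u·log X·u⁻¹` `B7Prop1Explicit.mlog_units_conj`, `log X⁻¹ = −log X`
`B9Eq3114Proof.mlog_units_inv`, §2, and removal of the two residual conjugations by `P = 1 + O(a)`, `AveragingDeficitNearIdentity.norm_Ad_sub_le`,
`8a²`); **`covariant_bianchi_le_sfClass`**: on `MinimalActionRate.sfClass d L N ε k` the defect is `≤ 248·(ε·(L^k)^{−2})²` — FOURTH order in
`η = L^{−k}`, against the trivial `O(η²)` and the regular `O(η³)` size of `∇_U F` itself (`NE7EtaBackgroundEnergyClassAllCutoffs` §0): in the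
Weitzenböck step (E1) of (h7) the `‖d_U F‖²` term is `O(η⁸)` per site, below the `O(η⁶)` target of (H∃)ᴱ.
§4 (v1.1, append-only; `U(N)`) `covGrad_comm_eq` (exact: `∇_κ∇_μ G − ∇_μ∇_κ G = (Ad_{U(x,κ)U(x+e_κ,μ)} − Ad_{U(x,μ)U(x+e_μ,κ)}) G(x+e_κ+e_μ)`),
**`norm_covGrad_comm_le`**: `‖∇_κ(∇_μ G)(x) − ∇_μ(∇_κ G)(x)‖ ≤ 2a·‖G(x+e_κ+e_μ)‖` for ANY plaquette function `G` (`κ ≠ μ`) — the commutator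
of covariant differences is the plaquette `P_{κμ}(x) = 1 + O(a)`; the error source of (E1)'s integration by parts.
HONEST: elementary and exact∕second-order lattice algebra; no expansion, no Green's function, no printed statement used or asserted; it discharges
NOTHING of NE3∕NE7 by itself (the energy road's (E1) proper, (E2), (E3) and the interiority (8) remain, see the hunt memo); NE7 NOT proved.
-/

set_option autoImplicit false

open scoped BigOperators Matrix Matrix.Norms.L2Operator
open Finset NormedSpace

namespace Summit.QuantumFields.BalabanUV.T4Continuum.NE7LatticeBianchi

open Literature.MathematicalPhysics.QuantumFieldTheory.Balaban1983to89
open B7Prop1Explicit B7Prop2Explicit MatrixLog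
open T4AveragingDeficitWall hiding Site Plane Plaq Bond
open T4AveragingDeficitNonAbelian (Ad_mul Ad_sub)
open AveragingDeficitTransport (norm_Ad_of_unitary mem_U1_of_unitary)
open AveragingDeficitNearIdentity (norm_Ad_sub_le Ad_neg)
open B7Prop1Local (hol_plaqWord_eq)
open MinimalActionRate (sfClass)

noncomputable section

/-! ## §1 The cube identity (exact, any group) -/

section GroupLevel

variable {d : ℕ} {G : Type*} [Group G]

/-- The empty ladder is trivial: `V(ladder [] ν) = V(x,ν)·V(x,ν)⁻¹ = 1`. [folklore] -/
theorem hol_ladder_nil (V : Site d → Fin d → G) (x : Site d) (ν : Fin d) : hol V x (ladder [] ν) = 1 := by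
  rw [hol_ladder]
  simp

/-- **THE LATTICE BIANCHI IDENTITY (cube identity), exact, for ANY group**: the covariant transport defect of the `κμ`-plaquette
holonomy along `e_ν` equals the ordered product of the four SIDE faces of the cube `(x; κ, μ, ν)`, each conjugated by the partial
transport along `∂p_{κμ}`:
`P_{κμ}(x)·V(x,ν)·P_{κμ}(x+e_ν)⁻¹·V(x,ν)⁻¹ = Ad_{g₁g₂g₃} pl₄ · Ad_{g₁g₂} pl₃ · Ad_{g₁} pl₂ · pl₁` (non-abelian Stokes for the ladder over the
plaquette word, `hol_ladder` versus `hol_ladder_cons`). [folklore] -/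
theorem cube_identity (V : Site d → Fin d → G) (x : Site d) (κ μ ν : Fin d) :
    hol V x (plaqWord κ μ) * V x ν * (hol V (x + e ν) (plaqWord κ μ))⁻¹ * (V x ν)⁻¹ =
      (V x κ * ((V (x + e κ) μ * (((V (x + e μ) κ)⁻¹ * hol V (x + e μ) (lplaqWord ((μ, false) : Letter d) ν)
          * ((V (x + e μ) κ)⁻¹)⁻¹) * hol V (x + e κ + e μ) (lplaqWord ((κ, false) : Letter d) ν)) * (V (x + e κ) μ)⁻¹)
          * hol V (x + e κ) (plaqWord μ ν)) * (V x κ)⁻¹) * hol V x (plaqWord κ ν) := by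
  have h := hol_ladder V x (plaqWord κ μ) ν
  rw [disp_plaqWord, add_zero] at h
  rw [← h, plaqWord, hol_ladder_cons, hol_ladder_cons, hol_ladder_cons, hol_ladder_cons, hol_ladder_nil]
  simp only [stepHol_true, stepHol_false, Letter.vec_true, Letter.vec_false, lplaqWord_true, mul_one]
  have e1 : x + e κ + e μ + -e κ = x + e μ := by abel
  have e2 : x + e κ + e μ - e κ = x + e μ := by abel
  have e3 : x + e μ - e μ = x := by abel
  simp only [e1, e2, e3, inv_inv, inv_mul_cancel, one_mul]

end GroupLevel

/-! ### the face form -/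

section GroupFaces

variable {d : ℕ} {G : Type*} [Group G]

/-- The reversed side face: from `y + e_κ` the loop `lplaqWord (κ,−) ν` is the `κν`-plaquette at `y` traversed backwards,
`V(y,κ)⁻¹ · P_{κν}(y)⁻¹ · V(y,κ)`. [folklore] -/
theorem hol_lplaqWord_false (V : Site d → Fin d → G) (y : Site d) (κ ν : Fin d) :
    hol V (y + e κ) (lplaqWord ((κ, false) : Letter d) ν) = (V y κ)⁻¹ * (hol V y (plaqWord κ ν))⁻¹ * V y κ := by
  rw [hol_lplaqWord, hol_plaqWord_eq]
  have e1 : y + e κ - e κ = y := by abel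
  have e2 : y + e κ + e ν - e κ = y + e ν := by abel
  have e3 : y + e κ + -e κ = y := by abel
  simp only [stepHol_false, Letter.vec_false, e1, e2, e3, inv_inv, mul_inv_rev]
  group

/-- **THE CUBE IDENTITY IN FACE FORM** (any group): with `P_{ab}(y) := V(∂p_{ab}(y))`,
`P_{κμ}(x)·V(x,ν)·P_{κμ}(x+e_ν)⁻¹·V(x,ν)⁻¹ = [P Q⁻¹ P⁻¹]·[P D R′⁻¹ D⁻¹ P⁻¹]·[A Q′ A⁻¹]·R` where `P = P_{κμ}(x)`, `Q = P_{μν}(x)`,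
`Q′ = P_{μν}(x+e_κ)`, `R = P_{κν}(x)`, `R′ = P_{κν}(x+e_μ)`, `A = V(x,κ)`, `D = V(x,μ)`. [folklore] -/
theorem cube_identity_faces (V : Site d → Fin d → G) (x : Site d) (κ μ ν : Fin d) :
    hol V x (plaqWord κ μ) * V x ν * (hol V (x + e ν) (plaqWord κ μ))⁻¹ * (V x ν)⁻¹ =
      (hol V x (plaqWord κ μ) * (hol V x (plaqWord μ ν))⁻¹ * (hol V x (plaqWord κ μ))⁻¹) *
      (hol V x (plaqWord κ μ) * V x μ * (hol V (x + e μ) (plaqWord κ ν))⁻¹ * (V x μ)⁻¹ * (hol V x (plaqWord κ μ))⁻¹) *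
      (V x κ * hol V (x + e κ) (plaqWord μ ν) * (V x κ)⁻¹) * hol V x (plaqWord κ ν) := by
  rw [cube_identity, show x + e κ + e μ = (x + e μ) + e κ by abel, hol_lplaqWord_false, hol_lplaqWord_false,
    hol_plaqWord_eq V x κ μ]
  group

end GroupFaces

/-! ## §2 Two factors against four: the logarithms -/

section Abstract

variable {𝔸 : Type*} [NormedRing 𝔸] [NormedAlgebra ℂ 𝔸] [CompleteSpace 𝔸]

/-- **TWO FACTORS AGAINST FOUR**: if `X·Y = X₁·X₂·X₃·X₄` with all six within `a ≤ 1∕50` of `1`, then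
`‖(log X + log Y) − (log X₁ + log X₂ + log X₃ + log X₄)‖ ≤ 240·a²` (three applications of the product rule
`‖log(WX) − log W − log X‖ ≤ 4(p+q)²`, `B12Average05And08.norm_mlog_mul_sub_le`). [folklore] -/
theorem norm_mlog_two_four {X Y X₁ X₂ X₃ X₄ : 𝔸} {a : ℝ} (ha : a ≤ 1 / 50) (h : X * Y = X₁ * X₂ * X₃ * X₄)
    (hX : ‖X - 1‖ ≤ a) (hY : ‖Y - 1‖ ≤ a) (h₁ : ‖X₁ - 1‖ ≤ a) (h₂ : ‖X₂ - 1‖ ≤ a) (h₃ : ‖X₃ - 1‖ ≤ a)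
    (h₄ : ‖X₄ - 1‖ ≤ a) :
    ‖(mlog X + mlog Y) - (mlog X₁ + mlog X₂ + mlog X₃ + mlog X₄)‖ ≤ 240 * a ^ 2 := by
  have ha0 : 0 ≤ a := (norm_nonneg _).trans hX
  have h12 : ‖X₁ * X₂ - 1‖ ≤ 3 * a := by
    refine (B14Eq123Localization.norm_mul_sub_one_le X₁ X₂).trans ?_
    nlinarith [mul_le_mul h₁ h₂ (norm_nonneg _) ha0, norm_nonneg (X₁ - 1), norm_nonneg (X₂ - 1)]
  have h123 : ‖X₁ * X₂ * X₃ - 1‖ ≤ 5 * a := by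
    refine (B14Eq123Localization.norm_mul_sub_one_le (X₁ * X₂) X₃).trans ?_
    nlinarith [mul_le_mul h12 h₃ (norm_nonneg _) (by linarith), norm_nonneg (X₁ * X₂ - 1), norm_nonneg (X₃ - 1)]
  have eXY := B12Average05And08.norm_mlog_mul_sub_le hX hY (by linarith) (by linarith)
  have ec := B12Average05And08.norm_mlog_mul_sub_le h₁ h₂ (by linarith) (by linarith)
  have eb := B12Average05And08.norm_mlog_mul_sub_le h12 h₃ (by linarith) (by linarith)
  have ea := B12Average05And08.norm_mlog_mul_sub_le h123 h₄ (by linarith) (by linarith)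
  rw [← h] at ea
  have e : (mlog X + mlog Y) - (mlog X₁ + mlog X₂ + mlog X₃ + mlog X₄)
      = -(mlog (X * Y) - mlog X - mlog Y) + (mlog (X * Y) - mlog (X₁ * X₂ * X₃) - mlog X₄)
        + (mlog (X₁ * X₂ * X₃) - mlog (X₁ * X₂) - mlog X₃) + (mlog (X₁ * X₂) - mlog X₁ - mlog X₂) := by abel
  rw [e]
  have hsum : 4 * (a + a) ^ 2 + 4 * (5 * a + a) ^ 2 + 4 * (3 * a + a) ^ 2 + 4 * (a + a) ^ 2 = 240 * a ^ 2 := by ring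
  rw [← hsum]
  exact (norm_add_le _ _).trans (add_le_add ((norm_add_le _ _).trans (add_le_add ((norm_add_le _ _).trans
    (add_le_add (by rw [norm_neg]; exact eXY) ea)) eb)) ec)

end Abstract

/-! ## §3 The linearised covariant Bianchi identity for `U(N)` small fields -/

section Lattice

variable {d : ℕ} {n : Type*} [Fintype n] [DecidableEq n] [Nonempty n]

omit [Nonempty n] in
/-- `Ad_u` fixes `1`, so it preserves the distance to `1` for unitary `u`. [folklore] -/
theorem norm_Ad_sub_one {u : (Matrix n n ℂ)ˣ} (hu : u ∈ unitaryUnits (Matrix n n ℂ)) (Z : Matrix n n ℂ) : ‖Ad u Z - 1‖ = ‖Z - 1‖ := by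
  have h1 : Ad u (1 : Matrix n n ℂ) = 1 := by simp [Ad]
  rw [← norm_Ad_of_unitary hu (Z - 1), Ad_sub, h1]

omit [Nonempty n] in
/-- The flux in components: `F(y; κ<μ) = log V(∂p_{κμ}(y))`. [folklore] -/
theorem flux_eq_mlog_hol (U : Site d → Fin d → (Matrix n n ℂ)ˣ) (y : Site d) {κ μ : Fin d} (h : κ < μ) :
    flux U (y, ⟨(κ, μ), h⟩) = mlog ((hol U y (plaqWord κ μ) : (Matrix n n ℂ)ˣ) : (Matrix n n ℂ)) := rfl

/-- **THE COVARIANT LATTICE BIANCHI IDENTITY, LINEARISED**: for a `U(N)`-valued configuration whose plaquette variables are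
within `a ≤ 1∕50` of `1`, the covariant exterior derivative of the flux `F = log V(∂p)` over every elementary cube is SECOND ORDER:
`‖∇_κ F_{μν}(x) − ∇_μ F_{κν}(x) + ∇_ν F_{κμ}(x)‖ ≤ 248·a²` (`κ < μ < ν`; `∇` = `T4AveragingDeficitWall.covGrad`, the one-step
transported forward difference).  Proof: the exact cube identity `cube_identity_faces` in `U(N)`, logarithms of the two sides
(`norm_mlog_two_four`: product rule thrice, `240a²`), `log(uXu⁻¹) = u(log X)u⁻¹`, `log X⁻¹ = −log X`, and removal of the two residual
conjugations by the plaquette `P_{κμ}(x) = 1 + O(a)` (`‖Ad_P Y − Y‖ ≤ 2‖P − 1‖‖Y‖`, `8a²`).  No expansion beyond second order, no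
Baker–Campbell–Hausdorff series. [folklore] -/
theorem covariant_bianchi_le {U : Site d → Fin d → (Matrix n n ℂ)ˣ} (hU : IsUnitaryCfg U) {a : ℝ} (ha : a ≤ 1 / 50)
    (hUa : SmallField U a) (x : Site d) {κ μ ν : Fin d} (hκμ : κ < μ) (hμν : μ < ν) :
    ‖covGrad U (flux U) x κ ⟨(μ, ν), hμν⟩ - covGrad U (flux U) x μ ⟨(κ, ν), hκμ.trans hμν⟩
        + covGrad U (flux U) x ν ⟨(κ, μ), hκμ⟩‖ ≤ 248 * a ^ 2 := by
  have hκν : κ < ν := hκμ.trans hμν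
  -- the atoms
  set P : (Matrix n n ℂ)ˣ := hol U x (plaqWord κ μ) with hPdef
  set P' : (Matrix n n ℂ)ˣ := hol U (x + e ν) (plaqWord κ μ) with hP'def
  set W : (Matrix n n ℂ)ˣ := U x ν with hWdef
  set Q : (Matrix n n ℂ)ˣ := hol U x (plaqWord μ ν) with hQdef
  set Q' : (Matrix n n ℂ)ˣ := hol U (x + e κ) (plaqWord μ ν) with hQ'def
  set R : (Matrix n n ℂ)ˣ := hol U x (plaqWord κ ν) with hRdef
  set R' : (Matrix n n ℂ)ˣ := hol U (x + e μ) (plaqWord κ ν) with hR'def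
  set A : (Matrix n n ℂ)ˣ := U x κ with hAdef
  set D : (Matrix n n ℂ)ˣ := U x μ with hDdef
  have hunit : ∀ (y : Site d) (w : List (Letter d)), hol U y w ∈ unitaryUnits (Matrix n n ℂ) := hol_mem_of hU
  have hPu : P ∈ unitaryUnits (Matrix n n ℂ) := hunit _ _
  have hP'u : P' ∈ unitaryUnits (Matrix n n ℂ) := hunit _ _
  have hQu : Q ∈ unitaryUnits (Matrix n n ℂ) := hunit _ _
  have hR'u : R' ∈ unitaryUnits (Matrix n n ℂ) := hunit _ _
  have hWu : W ∈ unitaryUnits (Matrix n n ℂ) := hU x ν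
  have hAu : A ∈ unitaryUnits (Matrix n n ℂ) := hU x κ
  have hDu : D ∈ unitaryUnits (Matrix n n ℂ) := hU x μ
  have hPDu : P * D ∈ unitaryUnits (Matrix n n ℂ) := (unitaryUnits (Matrix n n ℂ)).mul_mem hPu hDu
  -- the six faces are within `a` of `1`
  have ha0 : 0 ≤ a := (norm_nonneg _).trans (hUa x κ μ hκμ.ne)
  have hPa : ‖(P : (Matrix n n ℂ)) - 1‖ ≤ a := hUa x κ μ hκμ.ne
  have hP'a : ‖(P' : (Matrix n n ℂ)) - 1‖ ≤ a := hUa (x + e ν) κ μ hκμ.ne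
  have hQa : ‖(Q : (Matrix n n ℂ)) - 1‖ ≤ a := hUa x μ ν hμν.ne
  have hQ'a : ‖(Q' : (Matrix n n ℂ)) - 1‖ ≤ a := hUa (x + e κ) μ ν hμν.ne
  have hRa : ‖(R : (Matrix n n ℂ)) - 1‖ ≤ a := hUa x κ ν hκν.ne
  have hR'a : ‖(R' : (Matrix n n ℂ)) - 1‖ ≤ a := hUa (x + e μ) κ ν hκν.ne
  have hP'ia : ‖((P'⁻¹ : (Matrix n n ℂ)ˣ) : (Matrix n n ℂ)) - 1‖ ≤ a := (norm_inv_sub_one_le (mem_U1_of_unitary hP'u)).trans hP'a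
  have hQia : ‖((Q⁻¹ : (Matrix n n ℂ)ˣ) : (Matrix n n ℂ)) - 1‖ ≤ a := (norm_inv_sub_one_le (mem_U1_of_unitary hQu)).trans hQa
  have hR'ia : ‖((R'⁻¹ : (Matrix n n ℂ)ˣ) : (Matrix n n ℂ)) - 1‖ ≤ a := (norm_inv_sub_one_le (mem_U1_of_unitary hR'u)).trans hR'a
  -- the cube identity at matrix level: TWO factors = FOUR factors
  have hg := cube_identity_faces U x κ μ ν
  have hm : (P : (Matrix n n ℂ)) * Ad W ((P'⁻¹ : (Matrix n n ℂ)ˣ) : (Matrix n n ℂ))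
      = Ad P ((Q⁻¹ : (Matrix n n ℂ)ˣ) : (Matrix n n ℂ)) * Ad (P * D) ((R'⁻¹ : (Matrix n n ℂ)ˣ) : (Matrix n n ℂ))
          * Ad A (Q' : (Matrix n n ℂ)) * (R : (Matrix n n ℂ)) := by
    have h' := congrArg (fun u : (Matrix n n ℂ)ˣ => (u : (Matrix n n ℂ))) hg
    simp only [Units.val_mul] at h'
    simp only [Ad, Units.val_mul, mul_inv_rev, mul_assoc] at h' ⊢
    exact h'
  have hY : ‖Ad W ((P'⁻¹ : (Matrix n n ℂ)ˣ) : (Matrix n n ℂ)) - 1‖ ≤ a := by rw [norm_Ad_sub_one hWu]; exact hP'ia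
  have h₁ : ‖Ad P ((Q⁻¹ : (Matrix n n ℂ)ˣ) : (Matrix n n ℂ)) - 1‖ ≤ a := by rw [norm_Ad_sub_one hPu]; exact hQia
  have h₂ : ‖Ad (P * D) ((R'⁻¹ : (Matrix n n ℂ)ˣ) : (Matrix n n ℂ)) - 1‖ ≤ a := by rw [norm_Ad_sub_one hPDu]; exact hR'ia
  have h₃ : ‖Ad A (Q' : (Matrix n n ℂ)) - 1‖ ≤ a := by rw [norm_Ad_sub_one hAu]; exact hQ'a
  have key := norm_mlog_two_four ha hm hPa hY h₁ h₂ h₃ hRa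
  -- the logarithms of the six factors
  have ha1 : a < 1 := by linarith
  have ha2 : a < 1 / 2 := by linarith
  have hlogY : mlog (Ad W ((P'⁻¹ : (Matrix n n ℂ)ˣ) : (Matrix n n ℂ))) = -Ad W (mlog (P' : (Matrix n n ℂ))) := by
    rw [show Ad W ((P'⁻¹ : (Matrix n n ℂ)ˣ) : (Matrix n n ℂ))
          = (W : (Matrix n n ℂ)) * ((P'⁻¹ : (Matrix n n ℂ)ˣ) : (Matrix n n ℂ)) * ((W⁻¹ : (Matrix n n ℂ)ˣ) : (Matrix n n ℂ)) from rfl,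
      mlog_units_conj (mem_U1_of_unitary hWu) (hP'ia.trans_lt ha1), B9Eq3114Proof.mlog_units_inv (hP'a.trans_lt ha2),
      ← Ad_neg]
    rfl
  have hlog₁ : mlog (Ad P ((Q⁻¹ : (Matrix n n ℂ)ˣ) : (Matrix n n ℂ))) = -Ad P (mlog (Q : (Matrix n n ℂ))) := by
    rw [show Ad P ((Q⁻¹ : (Matrix n n ℂ)ˣ) : (Matrix n n ℂ))
          = (P : (Matrix n n ℂ)) * ((Q⁻¹ : (Matrix n n ℂ)ˣ) : (Matrix n n ℂ)) * ((P⁻¹ : (Matrix n n ℂ)ˣ) : (Matrix n n ℂ)) from rfl,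
      mlog_units_conj (mem_U1_of_unitary hPu) (hQia.trans_lt ha1), B9Eq3114Proof.mlog_units_inv (hQa.trans_lt ha2),
      ← Ad_neg]
    rfl
  have hlog₂ : mlog (Ad (P * D) ((R'⁻¹ : (Matrix n n ℂ)ˣ) : (Matrix n n ℂ))) = -Ad P (Ad D (mlog (R' : (Matrix n n ℂ)))) := by
    rw [show Ad (P * D) ((R'⁻¹ : (Matrix n n ℂ)ˣ) : (Matrix n n ℂ))
          = ((P * D : (Matrix n n ℂ)ˣ) : (Matrix n n ℂ)) * ((R'⁻¹ : (Matrix n n ℂ)ˣ) : (Matrix n n ℂ)) * (((P * D)⁻¹ : (Matrix n n ℂ)ˣ) : (Matrix n n ℂ))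
        from rfl,
      mlog_units_conj (mem_U1_of_unitary hPDu) (hR'ia.trans_lt ha1), B9Eq3114Proof.mlog_units_inv (hR'a.trans_lt ha2),
      ← Ad_mul, ← Ad_neg]
    rfl
  have hlog₃ : mlog (Ad A (Q' : (Matrix n n ℂ))) = Ad A (mlog (Q' : (Matrix n n ℂ))) := by
    rw [show Ad A (Q' : (Matrix n n ℂ)) = (A : (Matrix n n ℂ)) * (Q' : (Matrix n n ℂ)) * ((A⁻¹ : (Matrix n n ℂ)ˣ) : (Matrix n n ℂ)) from rfl,
      mlog_units_conj (mem_U1_of_unitary hAu) (hQ'a.trans_lt ha1)]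
    rfl
  rw [hlogY, hlog₁, hlog₂, hlog₃] at key
  -- the flux letters
  have hF2 : ∀ {y : Site d} {w : List (Letter d)}, ‖((hol U y w : (Matrix n n ℂ)ˣ) : (Matrix n n ℂ)) - 1‖ ≤ a →
      ‖mlog ((hol U y w : (Matrix n n ℂ)ˣ) : (Matrix n n ℂ))‖ ≤ 2 * a :=
    fun h => (norm_mlog_le_two_mul (h.trans (by linarith))).trans (by linarith)
  have hrem₁ : ‖Ad P (mlog (Q : (Matrix n n ℂ))) - mlog (Q : (Matrix n n ℂ))‖ ≤ 4 * a ^ 2 := by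
    refine (norm_Ad_sub_le hPu _).trans ?_
    nlinarith [hF2 hQa, norm_nonneg (mlog (Q : (Matrix n n ℂ))), norm_nonneg ((P : (Matrix n n ℂ)) - 1)]
  have hrem₂ : ‖Ad P (Ad D (mlog (R' : (Matrix n n ℂ)))) - Ad D (mlog (R' : (Matrix n n ℂ)))‖ ≤ 4 * a ^ 2 := by
    refine (norm_Ad_sub_le hPu _).trans ?_
    rw [norm_Ad_of_unitary hDu]
    nlinarith [hF2 hR'a, norm_nonneg (mlog (R' : (Matrix n n ℂ))), norm_nonneg ((P : (Matrix n n ℂ)) - 1)]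
  -- assemble
  simp only [covGrad, flux_eq_mlog_hol]
  have e : Ad (U x κ) (mlog ((hol U (x + e κ) (plaqWord μ ν) : (Matrix n n ℂ)ˣ) : (Matrix n n ℂ)))
        - mlog ((hol U x (plaqWord μ ν) : (Matrix n n ℂ)ˣ) : (Matrix n n ℂ))
      - (Ad (U x μ) (mlog ((hol U (x + e μ) (plaqWord κ ν) : (Matrix n n ℂ)ˣ) : (Matrix n n ℂ)))
          - mlog ((hol U x (plaqWord κ ν) : (Matrix n n ℂ)ˣ) : (Matrix n n ℂ)))
      + (Ad (U x ν) (mlog ((hol U (x + e ν) (plaqWord κ μ) : (Matrix n n ℂ)ˣ) : (Matrix n n ℂ)))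
          - mlog ((hol U x (plaqWord κ μ) : (Matrix n n ℂ)ˣ) : (Matrix n n ℂ)))
      = -((mlog (P : (Matrix n n ℂ)) + -Ad W (mlog (P' : (Matrix n n ℂ))))
            - (-Ad P (mlog (Q : (Matrix n n ℂ))) + -Ad P (Ad D (mlog (R' : (Matrix n n ℂ)))) + Ad A (mlog (Q' : (Matrix n n ℂ))) + mlog (R : (Matrix n n ℂ))))
        + (Ad P (mlog (Q : (Matrix n n ℂ))) - mlog (Q : (Matrix n n ℂ))) + (Ad P (Ad D (mlog (R' : (Matrix n n ℂ)))) - Ad D (mlog (R' : (Matrix n n ℂ)))) := by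
    simp only [hPdef, hP'def, hWdef, hQdef, hQ'def, hRdef, hR'def, hAdef, hDdef]
    abel
  rw [e]
  exact norm_add₃_le.trans (by rw [norm_neg]; linarith [key, hrem₁, hrem₂])

/-- **ON THE SMALL-FIELD CLASS THE BIANCHI DEFECT IS FOURTH ORDER IN `η = L^{−k}`**: for `U ∈ sfClass d L N ε k` with `ε·(L^k)^{−2} ≤ 1∕50`,
`‖∇_κ F_{μν}(x) − ∇_μ F_{κν}(x) + ∇_ν F_{κμ}(x)‖ ≤ 248·(ε∕(L^k)²)²`. [folklore] -/
theorem covariant_bianchi_le_sfClass {L N k : ℕ} {ε : ℝ} (hε : ε / ((L : ℝ) ^ k) ^ 2 ≤ 1 / 50)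
    {U : Site d → Fin d → (Matrix n n ℂ)ˣ} (hU : U ∈ sfClass d L N ε k) (x : Site d) {κ μ ν : Fin d} (hκμ : κ < μ) (hμν : μ < ν) :
    ‖covGrad U (flux U) x κ ⟨(μ, ν), hμν⟩ - covGrad U (flux U) x μ ⟨(κ, ν), hκμ.trans hμν⟩
        + covGrad U (flux U) x ν ⟨(κ, μ), hκμ⟩‖ ≤ 248 * (ε / ((L : ℝ) ^ k) ^ 2) ^ 2 :=
  covariant_bianchi_le hU.1 hε hU.2.2 x hκμ hμν

end Lattice

/-! ## §4 (v1.1, append-only) Covariant differences commute up to the plaquette — the error source of the Weitzenböck step (E1) -/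

section Commutator

variable {d : ℕ} {n : Type*} [Fintype n] [DecidableEq n] [Nonempty n]

omit [Nonempty n] in
/-- **COVARIANT DIFFERENCES COMMUTE UP TO THE PLAQUETTE** (exact): for any plaquette function `G` and bond directions `κ, μ`,
`∇_κ(∇_μ G)(x) − ∇_μ(∇_κ G)(x) = (Ad_{U(x,κ)U(x+e_κ,μ)} − Ad_{U(x,μ)U(x+e_μ,κ)}) G(x+e_κ+e_μ)` — the three lower-order terms are symmetric
in `κ ↔ μ` (`∇ = covGrad U`, iterated through the plaquette function `p ↦ ∇_μ G(p)`). [folklore] -/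
theorem covGrad_comm_eq (U : Site d → Fin d → (Matrix n n ℂ)ˣ) (G : T4AveragingDeficitWall.Plaq d → Matrix n n ℂ) (x : Site d)
    (κ μ : Fin d) (π : T4AveragingDeficitWall.Plane d) :
    covGrad U (fun p => covGrad U G p.1 μ p.2) x κ π - covGrad U (fun p => covGrad U G p.1 κ p.2) x μ π
      = Ad (U x κ * U (x + e κ) μ) (G (x + e κ + e μ, π)) - Ad (U x μ * U (x + e μ) κ) (G (x + e κ + e μ, π)) := by
  simp only [covGrad, Ad_sub, Ad_mul, show x + e μ + e κ = x + e κ + e μ by abel]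
  abel

/-- **THE COMMUTATOR OF COVARIANT DIFFERENCES IS THE CURVATURE, IN NORM**: for `U(N)`-valued `U` with `‖U(∂p) − 1‖ ≤ a` on every
plaquette and `κ ≠ μ`, `‖∇_κ(∇_μ G)(x) − ∇_μ(∇_κ G)(x)‖ ≤ 2a·‖G(x+e_κ+e_μ)‖` — the two transports around the plaquette differ by
`P_{κμ}(x) = 1 + O(a)` (`Ad_A − Ad_B = Ad_B(Ad_{B⁻¹A} − 1)`, `B⁻¹A = Ad_{B⁻¹} P_{κμ}(x)`; `AveragingDeficitNearIdentity.norm_Ad_sub_le`).  This is the exact source of the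
`O(a·Σ‖F‖·‖∇F‖)` error term in the lattice Weitzenböck step (E1) of hunt (h7) (integration by parts exchanges `∇_κ` and `∇_μ`). [folklore] -/
theorem norm_covGrad_comm_le {U : Site d → Fin d → (Matrix n n ℂ)ˣ} (hU : IsUnitaryCfg U) {a : ℝ} (hUa : SmallField U a)
    (G : T4AveragingDeficitWall.Plaq d → Matrix n n ℂ) (x : Site d) {κ μ : Fin d} (hκμ : κ ≠ μ) (π : T4AveragingDeficitWall.Plane d) :
    ‖covGrad U (fun p => covGrad U G p.1 μ p.2) x κ π - covGrad U (fun p => covGrad U G p.1 κ p.2) x μ π‖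
      ≤ 2 * a * ‖G (x + e κ + e μ, π)‖ := by
  rw [covGrad_comm_eq]
  have hA : U x κ * U (x + e κ) μ ∈ unitaryUnits (Matrix n n ℂ) := (unitaryUnits _).mul_mem (hU x κ) (hU (x + e κ) μ)
  have hB : U x μ * U (x + e μ) κ ∈ unitaryUnits (Matrix n n ℂ) := (unitaryUnits _).mul_mem (hU x μ) (hU (x + e μ) κ)
  have hBA : (U x μ * U (x + e μ) κ)⁻¹ * (U x κ * U (x + e κ) μ) ∈ unitaryUnits (Matrix n n ℂ) :=
    (unitaryUnits _).mul_mem ((unitaryUnits _).inv_mem hB) hA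
  -- `Ad_A X − Ad_B X = Ad_B (Ad_{B⁻¹A} X − X)`
  have e1 : Ad (U x κ * U (x + e κ) μ) (G (x + e κ + e μ, π)) - Ad (U x μ * U (x + e μ) κ) (G (x + e κ + e μ, π))
      = Ad (U x μ * U (x + e μ) κ)
          (Ad ((U x μ * U (x + e μ) κ)⁻¹ * (U x κ * U (x + e κ) μ)) (G (x + e κ + e μ, π)) - G (x + e κ + e μ, π)) := by
    rw [Ad_sub, ← Ad_mul, mul_inv_cancel_left]
  rw [e1, norm_Ad_of_unitary hB]
  refine (norm_Ad_sub_le hBA _).trans ?_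
  -- `B⁻¹A = Ad_{B⁻¹} P_{κμ}(x)` is within `a` of `1`
  have hBA' : (U x μ * U (x + e μ) κ)⁻¹ * (U x κ * U (x + e κ) μ)
      = (U x μ * U (x + e μ) κ)⁻¹ * hol U x (plaqWord κ μ) * ((U x μ * U (x + e μ) κ)⁻¹)⁻¹ := by
    rw [hol_plaqWord_eq]; group
  have hval : (((U x μ * U (x + e μ) κ)⁻¹ * (U x κ * U (x + e κ) μ) : (Matrix n n ℂ)ˣ) : Matrix n n ℂ)
      = Ad (U x μ * U (x + e μ) κ)⁻¹ ((hol U x (plaqWord κ μ) : (Matrix n n ℂ)ˣ) : Matrix n n ℂ) := by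
    rw [hBA']; simp only [Ad, Units.val_mul]
  have hsmall : ‖(((U x μ * U (x + e μ) κ)⁻¹ * (U x κ * U (x + e κ) μ) : (Matrix n n ℂ)ˣ) : Matrix n n ℂ) - 1‖ ≤ a := by
    rw [hval, norm_Ad_sub_one ((unitaryUnits _).inv_mem hB)]
    exact hUa x κ μ hκμ
  have hX := norm_nonneg (G (x + e κ + e μ, π))
  nlinarith

end Commutator

end

end Summit.QuantumFields.BalabanUV.T4Continuum.NE7LatticeBianchi
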